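import Summits.ValiantsHypothesis.ValiantsHypothesis.Theorems.LacunarySymmetroidMatrixDescartesCensusV20Check

/-!
# `MatrixDescartes` census — a kernel-evaluable CHECKER for CHAMBER-UNIFORM `V = 20` certificates (definitions)

HONEST FRAMING.  Object-search cell `pub-symmetroid`; door-A item `DoorA26 = PosRootLawAt 2 6 19`
(stmt-ValiantsHypothesis-19979; OPEN, typed, never asserted).  DEFINITIONS ONLY: a certificate language and a Boolean
checker (`CU.checkChamber`) for CHAMBER-UNIFORM magnitude certificates of the census line `Cruxes/DoorA26/Lines/census.lean`
(stub `stub_easyChambers`): ONE exponent-free certificate per cell (chamber order `ord` of the 21 atoms × orientation `s`) that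
excludes a hypothetical Descartes-sharp twenty for EVERY support `d` of the chamber.  It re-implements, as data checked by
`decide +kernel`, what the door-p2 generators gen4 / gen7 / gen7p / gen7geo replay file by file (10–110 files per chamber):
single-monomial DOMINATION of a Gram identity (`G3, RCS, W ≥ 0` of `…CensusV20Check`, and the rank rows `M4 = 0`) whose
competitor bounds consist of an ABEL step over the chamber-uniform Newton cone (prefix forms certified non-positive on the chamber
cone by Farkas multipliers over the 20 consecutive gap forms), an exact TRANSPORT of the gap logarithms (AM–GM arcs
`∏ P ≤ (r·N)^m` from `Σ P ≤ m·r·N`, again by Farkas multipliers), optional Gram magnitude rows (`V20.RowSpec.one/amgm`, the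
T row), all with natural multipliers under a root degree `D`, and a final comparison in `ℚ`; plus odd definite triangles, case
splits on the sign of a linear form in `d` (PIECES) and case splits on a magnitude row.  Semantics and soundness:
`…CensusCUSound*`.  Nothing is proved here.  Nothing here bears on `V = 19`, on `DoorA26` itself (OPEN), on `MatrixDescartes`
(stmt-ValiantsHypothesis-18050) or on `VP ≠ VNP`.

[folklore] Bookkeeping / certificate replay; elementary.
-/

-- the D-0017 layout repeats a namespace component (single-conjunct summit); the `dupNamespace` linter flags it; name mandated.
set_option linter.dupNamespace false

namespace Summit.ValiantsHypothesis.ValiantsHypothesis.Theorems.LacunarySymmetroidMatrixDescartes.Census.CU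

open V20 (Atom Term PolySpec allAtoms posOf qA cA termNeg posTerms posl negAt FNat fval Row RowSpec buildRow)

/-! ## Linear forms in the six exponents `d₀ … d₅` -/

/-- A linear form `Σ cᵢ · dᵢ` in the exponents, by its six integer coefficients. [folklore] -/
structure LinD where
  /-- coefficient of `d₀` -/
  c0 : ℤ
  /-- coefficient of `d₁` -/
  c1 : ℤ
  /-- coefficient of `d₂` -/
  c2 : ℤ
  /-- coefficient of `d₃` -/
  c3 : ℤ
  /-- coefficient of `d₄` -/
  c4 : ℤ
  /-- coefficient of `d₅` -/
  c5 : ℤ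
deriving DecidableEq

/-- The zero form. [folklore] -/
def ld0 : LinD := ⟨0, 0, 0, 0, 0, 0⟩

/-- Sum of two forms. [folklore] -/
def ldAdd (F G : LinD) : LinD := ⟨F.c0 + G.c0, F.c1 + G.c1, F.c2 + G.c2, F.c3 + G.c3, F.c4 + G.c4, F.c5 + G.c5⟩

/-- Scalar multiple of a form. [folklore] -/
def ldSmul (z : ℤ) (F : LinD) : LinD := ⟨z * F.c0, z * F.c1, z * F.c2, z * F.c3, z * F.c4, z * F.c5⟩

/-- Difference of two forms. [folklore] -/
def ldSub (F G : LinD) : LinD := ldAdd F (ldSmul (-1) G)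

/-- The coordinate form `dᵢ` (zero form if `i ≥ 6`). [folklore] -/
def ldUnit (i : ℕ) : LinD :=
  ⟨if i = 0 then 1 else 0, if i = 1 then 1 else 0, if i = 2 then 1 else 0, if i = 3 then 1 else 0,
    if i = 4 then 1 else 0, if i = 5 then 1 else 0⟩

/-- The pair-sum form `dᵢ + dⱼ` of an atom `(i, j)`. [folklore] -/
def atomForm (a : Atom) : LinD := ldAdd (ldUnit a.1) (ldUnit a.2)

/-- The pair-sum form `E_t` at position `t` of the order. [folklore] -/
def Eform (ord : List Atom) (t : ℕ) : LinD := atomForm (ord.getD t (0, 0))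

/-- The form `E_t − E_s` of a pair of positions `(s, t)` (positive on the chamber when `s < t`). [folklore] -/
def pairForm (ord : List Atom) (p : ℕ × ℕ) : LinD := ldSub (Eform ord p.2) (Eform ord p.1)

/-- The 20 consecutive gap forms `E_{i+1} − E_i`, `i = 0 … 19`: the chamber cone is where they are all positive. [folklore] -/
def baseCtx (ord : List Atom) : List LinD := (List.range 20).map fun i => pairForm ord (i, i + 1)

/-- Natural-multiplier combination `Σ μᵢ · ctxᵢ` of context forms (surplus multipliers ignored, missing ones are `0`). [folklore] -/
def ctxComb : List LinD → List ℕ → LinD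
  | _, [] => ld0
  | [], _ => ld0
  | F :: ctx, m :: mu => ldAdd (ldSmul (m : ℤ) F) (ctxComb ctx mu)

/-- A Farkas certificate that a form is `≥ 0` wherever all context forms are: `ν · F = Σ μᵢ · ctxᵢ`, `ν > 0`. [folklore] -/
structure Fk where
  /-- positive scale of the target form -/
  nu : ℕ
  /-- natural multipliers of the context forms -/
  mu : List ℕ

/-- Check a Farkas certificate for `F ≥ 0` on the context. [folklore] -/
def farkasOK (ctx : List LinD) (F : LinD) (c : Fk) : Bool :=
  decide (0 < c.nu) && decide (ldSmul (c.nu : ℤ) F = ctxComb ctx c.mu)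

/-! ## Vectors over the 21 positions (integer lists of length 21) -/

/-- The zero vector. [folklore] -/
def z21 : List ℤ := List.replicate 21 0

/-- Add `z` to entry `p`. [folklore] -/
def vbump : List ℤ → ℕ → ℤ → List ℤ
  | [], _, _ => []
  | v :: vs, 0, z => (v + z) :: vs
  | v :: vs, p + 1, z => v :: vbump vs p z

/-- Add `z` at every position of `ps`. [folklore] -/
def vbumps (v : List ℤ) (ps : List ℕ) (z : ℤ) : List ℤ := ps.foldl (fun w p => vbump w p z) v

/-- Pointwise sum. [folklore] -/
def vAdd (v w : List ℤ) : List ℤ := List.zipWith (· + ·) v w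

/-- Scalar multiple. [folklore] -/
def vSmul (z : ℤ) (v : List ℤ) : List ℤ := v.map (z * ·)

/-- Sum of the entries. [folklore] -/
def vSum : List ℤ → ℤ
  | [] => 0
  | a :: v => a + vSum v

/-- Suffix sums: `suffixSums [v₀,…,v_n] = [T₀,…,T_n]`, `Tᵢ = Σ_{t ≥ i} v_t`. [folklore] -/
def suffixSums : List ℤ → List ℤ
  | [] => []
  | a :: v => (a + vSum v) :: suffixSums v

/-! ## Magnitude rows `Σ_t w_t · log x_t ≤ log (kn / kd)` -/

/-- A magnitude row `Σ_t w_t · ℓ_t ≤ log (kn / kd)` in the log-absolute coefficients `ℓ_t = log x_t`. [folklore] -/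
structure LRow where
  /-- integer weights over the 21 positions -/
  w : List ℤ
  /-- numerator of the constant -/
  kn : ℕ
  /-- denominator of the constant -/
  kd : ℕ

/-- The magnitude row of a `V20` row `∏_L x · Bden ≤ ∏_R x · Bnum`: weights `#L − #R`, constant `Bnum / Bden`. [folklore] -/
def lrowOfRow (r : Row) : LRow :=
  { w := vbumps (vbumps z21 r.L 1) r.R (-1), kn := fval r.Bnum, kd := fval r.Bden }

/-- Row specifications a competitor may use: a Gram row of `…CensusV20Check` (`one` / `amgm`; NOT `c25` — the Newton cone
enters through the Abel step), the T row `|β_ik|·q_j ≤ 4·|β_ij|·|β_jk|` (three definite letters), or a context magnitude row. [folklore] -/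
inductive LSpec where
  /-- a `V20` Gram row (`RowSpec.one` or `RowSpec.amgm`) -/
  | gram (rs : RowSpec)
  /-- the T row through the definite letters `i, j, k` (middle letter `j`) -/
  | trow (i j k : ℕ)
  /-- the `i`-th magnitude row of the context -/
  | ctx (i : ℕ)

/-- The T row as a magnitude row: `ℓ(β_ik) + ℓ(q_j) − ℓ(β_ij) − ℓ(β_jk) ≤ log 4`. [folklore] -/
def trowL (ord : List Atom) (i j k : ℕ) : LRow :=
  { w := vbumps (vbumps z21 [posOf (cA i k) ord, posOf (qA j) ord] 1) [posOf (cA i j) ord, posOf (cA j k) ord] (-1),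
    kn := 4, kd := 1 }

/-- Side conditions of the T row: three distinct definite letters. [folklore] -/
def trowOK (ord : List Atom) (s : Bool) (i j k : ℕ) : Bool :=
  decide (i < 6 ∧ j < 6 ∧ k < 6 ∧ i ≠ j ∧ j ≠ k ∧ i ≠ k) &&
    !negAt s (posOf (qA i) ord) && !negAt s (posOf (qA j) ord) && !negAt s (posOf (qA k) ord)

/-- Build a magnitude row (the `V20` builder is called with the empty support: `one`/`amgm` rows do not read it). [folklore] -/
def buildLRow (ctxL : List LRow) (ord : List Atom) (s : Bool) : LSpec → Option LRow
  | .gram (.c25 _) => none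
  | .gram rs => (buildRow [] ord s rs).map lrowOfRow
  | .trow i j k => if trowOK ord s i j k then some (trowL ord i j k) else none
  | .ctx i => ctxL[i]?

/-! ## Gram identities available for domination: the `V20` inequalities and the rank rows `M4 = 0` -/

/-- The 24 permutations of `[0,1,2,3]` with their signs. [folklore] -/
def perms4 : List (ℤ × List ℕ) :=
  [(1, [0,1,2,3]), (-1, [0,1,3,2]), (-1, [0,2,1,3]), (1, [0,2,3,1]), (1, [0,3,1,2]), (-1, [0,3,2,1]),
   (-1, [1,0,2,3]), (1, [1,0,3,2]), (1, [1,2,0,3]), (-1, [1,2,3,0]), (-1, [1,3,0,2]), (1, [1,3,2,0]),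
   (1, [2,0,1,3]), (-1, [2,0,3,1]), (-1, [2,1,0,3]), (1, [2,1,3,0]), (1, [2,3,0,1]), (-1, [2,3,1,0]),
   (-1, [3,0,1,2]), (1, [3,0,2,1]), (1, [3,1,0,2]), (-1, [3,1,2,0]), (-1, [3,2,0,1]), (1, [3,2,1,0])]

/-- One Leibniz term of the `4 × 4` Gram minor with rows `r` and columns `c`: atoms `(r_a, c_{π a})`, coefficient
`sgn π · 2^{#diagonal atoms}` (the Gram entry is `q_i` on the diagonal and `β_ij / 2` off it; the global factor `2⁴` is cleared). [folklore] -/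
def m4Term (r c : List ℕ) (sp : ℤ × List ℕ) : Term :=
  let atoms := (List.range 4).map fun a => cA (r.getD a 0) (c.getD (sp.2.getD a 0) 0)
  let ndiag := ((List.range 4).filter fun a => r.getD a 0 = c.getD (sp.2.getD a 0) 0).length
  (sp.1 * 2 ^ ndiag, atoms)

/-- Insert into a sorted list of naturals. [folklore] -/
def insNat (a : ℕ) : List ℕ → List ℕ
  | [] => [a]
  | b :: l => if a ≤ b then a :: b :: l else b :: insNat a l

/-- Sorted key of an atom list (for merging equal monomials). [folklore] -/
def atomKey (A : List Atom) : List ℕ := (A.map fun a => 6 * a.1 + a.2).foldr insNat []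

/-- Add a term into a list of terms, merging it with an equal monomial. [folklore] -/
def addTerm : List Term → Term → List Term
  | [], T => [T]
  | U :: P, T => if atomKey U.2 = atomKey T.2 then (U.1 + T.1, U.2) :: P else U :: addTerm P T

/-- Merge equal monomials, then drop zero coefficients. [folklore] -/
def mergeTerms (P : List Term) : List Term := (P.foldl addTerm []).filter fun T => T.1 ≠ 0

/-- The rank row `M4(r | c)`: `2⁴ ×` the `4 × 4` minor of the Gram matrix `(B(S_i, S_j))` with rows `r`, columns `c` — it
VANISHES (six letters in the `3`-space `Sym₂(ℝ)`); monomials merged. [folklore] -/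
def m4Poly (r c : List ℕ) : List Term := mergeTerms (perms4.map (m4Term r c))

/-- The polynomial identities a domination certificate may name. [folklore] -/
inductive PSpec where
  /-- a `V20` inequality `G3 / RCS / W ≥ 0` -/
  | ineq (P : PolySpec)
  /-- a rank row `M4(r | c) = 0` (`r`, `c`: four letters each) -/
  | m4 (r c : List ℕ)

/-- Index validity. [folklore] -/
def PSpec.valid : PSpec → Bool
  | .ineq P => P.valid
  | .m4 r c => decide (r.length = 4 ∧ c.length = 4) && decide (∀ i ∈ r, i < 6) && decide (∀ i ∈ c, i < 6)

/-- The term list. [folklore] -/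
def PSpec.poly : PSpec → List Term
  | .ineq P => P.poly
  | .m4 r c => m4Poly r c

/-- Side condition under the sign pattern (`RCS` needs a definite first letter). [folklore] -/
def PSpec.defOK (ord : List Atom) (s : Bool) : PSpec → Bool
  | .ineq P => P.defOK ord s
  | .m4 _ _ => true

/-- Is the identity an equality (`M4 = 0`) rather than an inequality `≥ 0`? [folklore] -/
def PSpec.isEq : PSpec → Bool
  | .ineq _ => false
  | .m4 _ _ => true

/-! ## Transport arcs -/

/-- A transport arc: pair differences `P₁ … P_m` (pairs of positions `(s, t)`, `s < t`) against one pair difference `N` with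
ratio `rn / rd`: `fk` certifies `rd · Σ Pᵢ ≤ m · rn · N` on the context cone, whence `Σ log Pᵢ ≤ m · (log N + log (rn / rd))`. [folklore] -/
structure Arc where
  /-- the small side: pairs of positions -/
  P : List (ℕ × ℕ)
  /-- the large side: one pair of positions -/
  N : ℕ × ℕ
  /-- ratio numerator -/
  rn : ℕ
  /-- ratio denominator -/
  rd : ℕ
  /-- Farkas certificate of `m·rn·N − rd·ΣP ≥ 0` -/
  fk : Fk

/-- A pair of positions is valid: `s < t < 21`. [folklore] -/
def pairOK (p : ℕ × ℕ) : Bool := decide (p.1 < p.2 ∧ p.2 < 21)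

/-- Sum of the forms of a list of pairs. [folklore] -/
def pairSumForm (ord : List Atom) : List (ℕ × ℕ) → LinD
  | [] => ld0
  | p :: ps => ldAdd (pairForm ord p) (pairSumForm ord ps)

/-- Check an arc. [folklore] -/
def arcOK (ctx : List LinD) (ord : List Atom) (a : Arc) : Bool :=
  decide (a.P ≠ [] ∧ a.P.length ≤ 4) && a.P.all pairOK && pairOK a.N && decide (0 < a.rn) && decide (0 < a.rd) &&
    farkasOK ctx (ldSub (ldSmul ((a.P.length * a.rn : ℕ) : ℤ) (pairForm ord a.N)) (ldSmul (a.rd : ℤ) (pairSumForm ord a.P)))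
      a.fk

/-- Weights attached to pair-difference FORMS (two pairs of positions with the same form `E_t − E_s` have the same logarithm,
so transport balances per form, not per pair): an association list, merged on insertion. [folklore] -/
def fwIns : List (LinD × ℤ) → LinD → ℤ → List (LinD × ℤ)
  | [], F, z => [(F, z)]
  | (G, y) :: L, F, z => if G = F then (G, y + z) :: L else (G, y) :: fwIns L F z

/-- Add the weights of an arc with multiplicity `z`: `+z` on the form of each `Pᵢ`, `−m·z` on the form of `N`. [folklore] -/
def arcWeightsF (ord : List Atom) (acc : List (LinD × ℤ)) (a : Arc) (z : ℕ) : List (LinD × ℤ) :=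
  fwIns (a.P.foldl (fun w p => fwIns w (pairForm ord p) (z : ℤ)) acc) (pairForm ord a.N) (-((a.P.length * z : ℕ) : ℤ))

/-- Total form weights of a list of arcs with multiplicities. [folklore] -/
def arcsWeightsF (ord : List Atom) (arcs : List (Arc × ℕ)) : List (LinD × ℤ) :=
  arcs.foldl (fun acc az => arcWeightsF ord acc az.1 az.2) []

/-- Subtract the TARGET form weights of an Abel vector `b` — the target is `−(b_s + b_t)` on the form of every pair `s < t < 21`,
so this adds `+(b_s + b_t)`. [folklore] -/
def subTarget (ord : List Atom) (b : List ℤ) (acc : List (LinD × ℤ)) : List (LinD × ℤ) :=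
  (List.range 21).foldl (fun w t => (List.range t).foldl (fun w' s => fwIns w' (pairForm ord (s, t)) (b.getD s 0 + b.getD t 0)) w) acc

/-- Transport balance: arcs minus target is `≥ 0` on every form (a surplus `+r·log F`, `F` a pair difference of natural exponents,
hence `log F ≥ 0`, only weakens the bound that is being certified). [folklore] -/
def balanceOK (ord : List Atom) (b : List ℤ) (arcs : List (Arc × ℕ)) : Bool :=
  (subTarget ord b (arcsWeightsF ord arcs)).all fun e => decide (0 ≤ e.2)

/-! ## Competitors and the Abel step -/

/-- One competitor `k` of a domination certificate: root degree `D`, magnitude rows with multipliers, the 19 Farkas certificates of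
the Abel prefix conditions, the transport arcs with multiplicities, and the numerator `un` of its bound `u_k = un / ud`. [folklore] -/
structure Comp where
  /-- index of the competitor term -/
  k : ℕ
  /-- root degree (`> 0`) -/
  D : ℕ
  /-- magnitude rows with natural multipliers -/
  rows : List (LSpec × ℕ)
  /-- Farkas certificates for `−C_j ≥ 0`, `j = 1 … 19` -/
  abel : List Fk
  /-- transport arcs with natural multiplicities -/
  arcs : List (Arc × ℕ)
  /-- numerator of the bound -/
  un : ℕ

/-- Build all magnitude rows of a competitor; `none` if one is invalid. [folklore] -/
def buildLRows (ctxL : List LRow) (ord : List Atom) (s : Bool) : List (LSpec × ℕ) → Option (List (LRow × ℕ))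
  | [] => some []
  | (ls, n) :: rest =>
    match buildLRow ctxL ord s ls, buildLRows ctxL ord s rest with
    | some r, some rr => some ((r, n) :: rr)
    | _, _ => none

/-- `Σ y_r · w_r` over built rows. [folklore] -/
def rowsWeight : List (LRow × ℕ) → List ℤ
  | [] => z21
  | (r, n) :: rest => vAdd (vSmul (n : ℤ) r.w) (rowsWeight rest)

/-- `∏ (kn_r / kd_r)^{y_r}` over built rows. [folklore] -/
def rowsConst : List (LRow × ℕ) → ℚ
  | [] => 1
  | (r, n) :: rest => ((r.kn : ℚ) / r.kd) ^ n * rowsConst rest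

/-- All built rows have positive constants and 21 weights. [folklore] -/
def rowsWF (rs : List (LRow × ℕ)) : Bool := rs.all fun rn => decide (0 < rn.1.kn ∧ 0 < rn.1.kd ∧ rn.1.w.length = 21)

/-- `∏ (rn_a / rd_a)^{m_a · z_a}` over arcs. [folklore] -/
def arcsConst : List (Arc × ℕ) → ℚ
  | [] => 1
  | (a, z) :: rest => ((a.rn : ℚ) / a.rd) ^ (a.P.length * z) * arcsConst rest

/-- The prefix form `C_j = Σ_{i < j} T_{i+1} · (E_{i+1} − E_i)` of an Abel vector with suffix sums `T = [T_0, …, T_20]`. [folklore] -/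
def prefixForm (ord : List Atom) (T : List ℤ) : ℕ → LinD
  | 0 => ld0
  | j + 1 => ldAdd (prefixForm ord T j) (ldSmul (T.getD (j + 1) 0) (pairForm ord (j, j + 1)))

/-- Check the Abel conditions of `b` on the context cone: `|b| = 21`, `Σ b = 0`, `C_20 = 0`, `−C_j ≥ 0` for `j = 1 … 19`. [folklore] -/
def abelOK (ctx : List LinD) (ord : List Atom) (b : List ℤ) (fks : List Fk) : Bool :=
  let T := suffixSums b
  decide (b.length = 21) && decide (vSum b = 0) && decide (prefixForm ord T 20 = ld0) && decide (fks.length = 19) &&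
    (List.range 19).all fun j => match fks[j]? with
      | some fk => farkasOK ctx (ldSmul (-1) (prefixForm ord T (j + 1))) fk
      | none => false

/-- The certified constant of a magnitude bound: for a target vector `a` over the positions and a root degree `D`, the rows,
Abel certificates and arcs prove `D · Σ_t a_t ℓ_t ≤ log q`; returns `q` (or `none` if a check fails). [folklore] -/
def boundConst (ctx : List LinD) (ctxL : List LRow) (ord : List Atom) (s : Bool) (a : List ℤ) (D : ℕ)
    (rows : List (LSpec × ℕ)) (abel : List Fk) (arcs : List (Arc × ℕ)) : Option ℚ :=
  match buildLRows ctxL ord s rows with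
  | none => none
  | some rs =>
    let b := vAdd (vSmul (D : ℤ) a) (vSmul (-1) (rowsWeight rs))
    if rowsWF rs && abelOK ctx ord b abel && (arcs.all fun az => arcOK ctx ord az.1) && balanceOK ord b arcs then
      some (rowsConst rs * arcsConst arcs)
    else none

/-- Check one competitor of a domination certificate for the identity with term list `P`, dominating term `n0`, denominator `ud`:
`|t_k| ≤ (un / ud) · |t_{n0}|`. [folklore] -/
def compOK (ctx : List LinD) (ctxL : List LRow) (ord : List Atom) (s : Bool) (P : List Term) (n0 ud : ℕ) (c : Comp) : Bool :=
  let T0 := P.getD n0 (0, [])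
  let Tk := P.getD c.k (0, [])
  let a := vbumps (vbumps z21 (posl ord Tk.2) 1) (posl ord T0.2) (-1)
  match boundConst ctx ctxL ord s a c.D c.rows c.abel c.arcs with
  | none => false
  | some q => decide (0 < c.D) && decide (0 < c.un) &&
      decide (((Tk.1.natAbs : ℚ) / T0.1.natAbs) ^ c.D * q * (ud : ℚ) ^ c.D ≤ (c.un : ℚ) ^ c.D)

/-! ## Certificates -/

/-- Certificates that a cell (chamber order, orientation) carries no twenty on ANY support of the chamber. [folklore] -/
inductive Cert where
  /-- odd definite triangle through the letters `i < j < k` -/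
  | sign (i j k : ℕ)
  /-- single-monomial domination of the identity `P` by its term `n0`, common denominator `ud` -/
  | dom (P : PSpec) (n0 : ℕ) (ud : ℕ) (comps : List Comp)
  /-- a pure LP refutation: magnitude rows + Abel step + transport prove `0 ≤ log q` with `q < 1` -/
  | lp (rows : List (LSpec × ℕ)) (abel : List Fk) (arcs : List (Arc × ℕ))
  /-- PIECES: case split on the sign of the linear form `h` in the exponents (`h ≥ 0` / `−h ≥ 0`) -/
  | splitD (h : LinD) (pos neg : Cert)
  /-- case split on a magnitude row: `Σ w ℓ ≤ log (kn / kd)` / `Σ (−w) ℓ ≤ log (kd / kn)` -/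
  | splitL (w : List ℤ) (kn kd : ℕ) (le ge : Cert)

/-- Check a domination certificate: valid identity, dominating term `n0` (negative under the pattern for an inequality),
every competitor (the positive terms for an inequality, all other terms for an equality) bounded, `Σ u_k < 1`. [folklore] -/
def domOK (ctx : List LinD) (ctxL : List LRow) (ord : List Atom) (s : Bool) (P : PSpec) (n0 ud : ℕ) (comps : List Comp) :
    Bool :=
  let poly := P.poly
  let need := if P.isEq then (List.range poly.length).filter (· ≠ n0) else posTerms ord s poly
  P.valid && P.defOK ord s && decide (n0 < poly.length) && (P.isEq || termNeg ord s (poly.getD n0 (0, []))) &&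
    decide (0 < ud) && decide (∀ T ∈ poly, T.1 ≠ 0) && decide (∀ T ∈ poly, ∀ a ∈ T.2, a ∈ allAtoms) &&
    decide (∀ k ∈ need, ∃ c ∈ comps, c.k = k) && decide (∀ c ∈ comps, c.k ∈ need) &&
    decide ((comps.map Comp.k).Nodup) && decide ((comps.map Comp.un).sum < ud) &&
    comps.all (compOK ctx ctxL ord s poly n0 ud)

/-- Check a certificate against a context of exponent forms (known `≥ 0`) and magnitude rows. [folklore] -/
def certOK (ord : List Atom) (s : Bool) : List LinD → List LRow → Cert → Bool
  | _, _, .sign i j k => V20.signOK ord s i j k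
  | ctx, ctxL, .dom P n0 ud comps => domOK ctx ctxL ord s P n0 ud comps
  | ctx, ctxL, .lp rows abel arcs =>
    match boundConst ctx ctxL ord s z21 1 rows abel arcs with
    | some q => decide (q < 1)
    | none => false
  | ctx, ctxL, .splitD h cp cn => certOK ord s (ctx ++ [h]) ctxL cp && certOK ord s (ctx ++ [ldSmul (-1) h]) ctxL cn
  | ctx, ctxL, .splitL w kn kd cle cge =>
    decide (w.length = 21) && decide (0 < kn) && decide (0 < kd) &&
      certOK ord s ctx (ctxL ++ [⟨w, kn, kd⟩]) cle && certOK ord s ctx (ctxL ++ [⟨vSmul (-1) w, kd, kn⟩]) cge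

/-- The order lists the 21 atoms, each once. [folklore] -/
def ordAtomsOK (ord : List Atom) : Bool :=
  decide (ord.length = 21) && decide (∀ a ∈ allAtoms, a ∈ ord) && decide (∀ b ∈ ord, b ∈ allAtoms)

/-- **Check a chamber**: the order is a permutation of the atoms and each orientation carries an accepted certificate
(`cpos`: lowest coefficient positive, `cneg`: negative). [folklore] -/
def checkChamber (ord : List Atom) (cpos cneg : Cert) : Bool :=
  ordAtomsOK ord && certOK ord true (baseCtx ord) [] cpos && certOK ord false (baseCtx ord) [] cneg

/-- The order of a chamber given as a function on `Fin 21` (the shape of `Census.chamber n` and of the landed rows). [folklore] -/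
def ofSigma (σ : Fin 21 → Fin 6 × Fin 6) : List Atom := List.ofFn fun t : Fin 21 => ((σ t).1.val, (σ t).2.val)

end Summit.ValiantsHypothesis.ValiantsHypothesis.Theorems.LacunarySymmetroidMatrixDescartes.Census.CU
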